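import Summits.AnomalousDissipation.AnomalousDissipation.Theses.EnsembleRigidity
import Summits.AnomalousDissipation.AnomalousDissipation.Theorems.EnsembleRigidityDefs
import Summits.AnomalousDissipation.AnomalousDissipation.Theorems.TaylorCertificatesSteadyStatesLoudBoundedStubGpAdmissible
import Summits.AnomalousDissipation.AnomalousDissipation.Theorems.EnsembleRigidityGPStatisticalRigidityLinearTestLimit
import Summits.AnomalousDissipation.AnomalousDissipation.Theorems.EnsembleRigidityGPStatisticalRigidityGpSmallEnergy
import Summits.AnomalousDissipation.AnomalousDissipation.Theorems.EnsembleRigidityGPStatisticalRigidityWeakDuality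
import Summits.AnomalousDissipation.AnomalousDissipation.Theorems.EnsembleRigidityGPStatisticalRigidityDesaturation
import Summits.AnomalousDissipation.AnomalousDissipation.Theorems.EnsembleRigidityGPStatisticalRigidityWeakDuality2
import Literature.Analysis.FluidPDE.CylindricalGenerator
import HarnessLib

/-!
# Route EnsembleRigidity — crux `GPStatisticalRigidity` (stmt-AnomalousDissipation-15508):
# skeleton of line `Sketch` (certificate / weak-duality architecture)

The crux (STATISTICAL LAMB RIGIDITY OF `f_GP`): for every energy level `E` there are `c, δ₀ > 0` such
that every Borel probability measure `μ` on `H = L²_σ(T³)` with integrable energy, mean energy `≤ E`,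
finite mean enstrophy `G`, non-negative shell work and cylindrical forced-Euler defect
`|∫ ⟨f_GP − B(v,v), Φ'(v)⟩ dμ| ≤ R (∫ ‖∇Φ'(v)‖² dμ)^{1/2}` (all cylindrical `Φ`), `0 ≤ R ≤ δ₀`, pays
`c ≤ R √G`.

## Architecture (idea `odd-lyapunov-certificate-family`, normal form `time-reversal-desaturation`)

* `stub_linearTestLimit` (L, provable, M) — REMOVING THE CUT-OFF: the cylindrical defect clause at
  radius `R` implies the fixed-test balance `|∫ ⟨f − B(v,v), w⟩ dμ| ≤ R ‖∇w‖₂` for every `w ∈ 𝒱`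
  (profiles `y ↦ y₀ χ(y/n)`, dominated convergence as `n → ∞`; only `∫|v|² dμ < ∞` is used).
* `stub_gpSmallEnergy` (S, provable, M) — THE SECOND-MOMENT TEST `w = f_GP`:
  `∫ ⟨f_GP − B(v,v), f_GP⟩ dμ ≥ 3/2 − 2π ∫|v|² dμ` (`‖f_GP‖₂² = 3/2`, `⟨∇f_GP(x) v, v⟩ ≥ −2π|v|²`) and
  `‖∇f_GP‖₂ = π√6`, so the balance at `w = f_GP` forces `R ≥ (3/2 − 2πE)/(π√6)`.
  With L this settles the crux VACUOUSLY at every level `E < 3/(4π)` (`gpRigid_smallEnergy`).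
* `stub_weakDuality` (W, provable, M) — √-LINEARISED WEAK DUALITY: if for every roughness scale
  `Λ > 0` there is a cylindrical certificate `Ψ_Λ` with `‖∇Ψ_Λ'(v)‖² ≤ C²(1 + ‖∇v‖²)` and the pointwise
  forced-Euler Lyapunov inequality `a − b|v|² − Λ⁻¹ ‖∇v‖ ‖∇Ψ_Λ'(v)‖ ≤ ⟨f − B(v,v), Ψ_Λ'(v)⟩` on
  finite-enstrophy fields, `b ≥ 0`, `a − bE ≥ γ > 0` (margin and cost `γ, C` uniform in `Λ`), then the
  crux's conclusion holds at level `E` with `c = δ₀ = γ/(4C)` (integrate, Cauchy–Schwarz in `μ`,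
  choose `Λ = 2C(1+G)/γ` after seeing `μ`).
* RESHAPE (cycle 1): the first shape of W/C (allowance `Λ⁻¹ ‖∇v‖ ‖∇Ψ'(v)‖`) cannot exist above the
  level `√12 ‖f_GP‖_{Ḣ⁻¹} ≈ 0.675`: along a ray `t u` with `u ⊥ gᵢ` the differential is frozen,
  `Ψ'(tu) = Ψ'(0) =: h`, the inequality at `v = 0` gives `a ≤ (f, h) ≤ ‖f‖_{Ḣ⁻¹}‖∇h‖₂`, and at
  `t → ∞` it gives `b ≥ sup_{u ⊥ g} −∫⟨sym∇h u,u⟩/|u|² = sup_x λ_max(−sym∇h(x)) ≥ ‖∇h‖₂/√12`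
  (concentration; `sym∇h` trace-free, `‖sym∇h‖₂² = ‖∇h‖₂²/2`), so `γ ≤ a − bE ≤ ‖∇h‖₂(‖f‖_{Ḣ⁻¹} − E/√12)`.
  The repaired shape charges roughness quadratically: `stub_weakDuality2` (W2, LANDED p130387)
  and
* `stub_gpCertificateFamily2` (C2, THE OPEN CONTENT) — for `E ≥ 3/(4π)` and every `Λ > 0` a cylindrical
  `Ψ_Λ` with `a − b|v|² − Λ⁻¹(1 + ‖∇v‖²) ≤ ⟨f_GP − B(v,v), Ψ_Λ'(v)⟩` on finite-enstrophy fields,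
  `b ≥ 0`, `a − bE ≥ γ > 0`, cost `‖∇Ψ_Λ'(v)‖² ≤ C²(1+‖∇v‖²)` (`γ, C` uniform in `Λ`): the Farkas-dual
  shape of "no admissible statistics of energy `≤ E`, enstrophy `≤ G₀`", positivity region
  `L²`-compact. NECESSARY CONDITIONS (crux-attack `Evidence.lean`, kill class): no exact
  finite-enstrophy Euler-stationary statistics of `f_GP` of mean energy `≤ E`; no invariant measure of
  any projected (Petrov–Galerkin) forced-Euler system in the core region.
* `stub_desaturation` (D, provable, M; SIDE STUB, not used in `_of`) — TIME-REVERSAL NORMAL FORM: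
  the rigidity conclusion WITH the shell-work hypothesis implies the one WITHOUT it (`v ↦ −v` is an
  exact symmetry of forced Euler with the same force; average `μ` with its push-forward), i.e. the
  shell clause of the crux carries no information; recorded so that refuters and later lines may work
  with even, zero-work statistics.
* `GPStatisticalRigidity_of` — the crux: `E < 3/(4π)` by L + S, else W2 applied to C2.

## References

* C. Foias, O. Manley, R. Rosa, R. Temam, *Navier–Stokes Equations and Turbulence* (CUP 2001),
  Ch. IV §1.2 Def. 1.3, (1.29)–(1.31). [FoiasManleyRosaTemam2001]
* R. Rosa, R. Temam, arXiv:2010.06730 (minimax / auxiliary functionals for statistical solutions).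
* I. Tobasco, D. Goluskin, C. Doering, arXiv:1705.07096 (sharpness of auxiliary-functional bounds).
-/

-- `Summit.<Summit>.<Problem>` is the tree's mandated summit-side namespace (CONVENTIONS §2); single-conjunct summit, duplicate deliberate.
set_option linter.dupNamespace false

noncomputable section

namespace Summit.AnomalousDissipation.AnomalousDissipation.Theorems.EnsembleRigidity.GPStatisticalRigidity

open MeasureTheory Filter Topology UnitAddTorus
open scoped InnerProductSpace RealInnerProductSpace ENNReal NNReal
open Literature.Analysis.FunctionSpaces Literature.Analysis.FluidPDE
open Summit.AnomalousDissipation.AnomalousDissipation.Theorems.EnsembleRigidity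

/-- Local notation: real vector fields on `T³`. -/
local notation "Vec3" => (UnitAddTorus (Fin 3)) → (EuclideanSpace ℝ (Fin 3))
/-- Local notation: `L²(T³; ℝ³)`. -/
local notation "L2" => (Lp (EuclideanSpace ℝ (Fin 3)) 2 (volume : Measure (UnitAddTorus (Fin 3))))
/-- Local notation: the energy space `H`. -/
local notation "H3" => (Torus.energySpace (Fin 3))

/-! ## Stubs (registered on stmt-AnomalousDissipation-15508)

LANDED (imported above, same namespace): `stub_linearTestLimit` (p129988), `stub_gpSmallEnergy`
(p130076), `stub_weakDuality` (p129953, first shape, superseded), `stub_desaturation` (p130125).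
RESHAPED (cycle 1): the first certificate shape `stub_gpCertificateFamily` (allowance
`Λ⁻¹‖∇v‖‖∇Ψ'(v)‖`) is FALSE above level `√12 ‖f_GP‖_{Ḣ⁻¹} ≈ 0.675` (concentration of the Reynolds
stress along rays invisible to the test coordinates; line notes) and is replaced by the Farkas-dual
shape `stub_gpCertificateFamily2` (allowance `Λ⁻¹(1 + ‖∇v‖²)`) with its weak duality
`stub_weakDuality2`. `stub_weakDuality2` LANDED (p130387). OPEN: `stub_gpCertificateFamily2` only. -/

/-- **C2 `stub_gpCertificateFamily2`** — THE OPEN CONTENT, REPAIRED SHAPE (reshape of C, cycle 1;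
idea `odd-lyapunov-certificate-family`). Above the second-moment horizon, `E ≥ 3/(4π)`, the
Galloway–Proctor force admits, for every roughness scale `Λ > 0`, a cylindrical Lyapunov certificate
`Ψ_Λ` of forced Euler with margin `γ(E) > 0` and relative `H¹`-cost `C(E)` uniform in `Λ`:
`a − b|v|² − Λ⁻¹(1 + ‖∇v‖²) ≤ ⟨f_GP − B(v,v), Ψ_Λ'(v)⟩` at every finite-enstrophy `v ∈ H`, `b ≥ 0`,
`a − bE ≥ γ`, `‖∇Ψ_Λ'(v)‖² ≤ C²(1 + ‖∇v‖²)`. WHY THIS SHAPE: it is the Farkas-dual form of "no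
probability measure on `H` of mean energy `≤ E` and mean enstrophy `≤ G₀ = Λ(a − bE) − 1` is
cylindrically stationary for forced Euler", with the roughness charged QUADRATICALLY so that the
positivity region `{b|v|² + Λ⁻¹‖∇v‖² < a}` is `L²`-compact (Rellich) — the first shape C (allowance
`Λ⁻¹‖∇v‖‖∇Ψ'(v)‖`, linear along rays `t u` with `u ⊥ gᵢ`) is FALSE above level `√12‖f_GP‖_{Ḣ⁻¹} ≈ 0.675`
by concentration of the Reynolds stress (line notes, cycle 1). NECESSARY CONDITIONS: every exact
finite-enstrophy Euler-stationary statistics of `f_GP` has mean energy `> E` (crux-attack kill class);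
for every finite test family `g` the projected (Petrov–Galerkin) forced-Euler field
`y ↦ ((f_GP, gᵢ) − b(v_y, v_y, gᵢ))ᵢ` has no invariant probability measure in the core
`{b|v_y|² + Λ⁻¹(1+‖∇v_y‖²) < a}` (so Galerkin dodgers of `f_GP` of energy `≤ E` must have enstrophy
`≳ γΛ` at the truncations used — the quantitative face of the crux). No such family is known in print. -/
theorem stub_gpCertificateFamily2 (f : Vec3) (hf : f = gpForce) (E : ℝ) (hE : 3 / (4 * Real.pi) ≤ E) :
    ∃ γ C : ℝ, 0 < γ ∧ 0 < C ∧ ∀ Λ : ℝ, 0 < Λ →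
      ∃ (Ψ : Torus.CylindricalTest (Fin 3)) (a b : ℝ), 0 ≤ b ∧ γ ≤ a - b * E ∧
        (∀ v : H3, Torus.gradNormSq (Ψ.grad v) ≤
          C ^ 2 * (1 + (Torus.eGradNormSq ((v : L2) : Vec3)).toReal)) ∧
        (∀ v : H3, Torus.eGradNormSq ((v : L2) : Vec3) ≠ ⊤ →
          a - b * ‖v‖ ^ 2 - Λ⁻¹ * (1 + (Torus.eGradNormSq ((v : L2) : Vec3)).toReal) ≤
            Torus.nsGeneratorPairing 0 f v (Ψ.grad v)) := by
  sorry

/-! ## The small-energy regime (L + S) -/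

/-- `f_GP` is smooth, divergence free and mean zero (landed `stub_gpAdmissible`). [folklore] -/
theorem gpForce_admissible :
    Torus.IsSmooth gpForce ∧ Torus.IsDivFree gpForce ∧ Torus.HasZeroMean gpForce :=
  SteadyStatesLoudBounded.GpAdmissible.stub_gpAdmissible

/-- **Rigidity below the second-moment horizon.** For `E < 3/(4π)` the crux's conclusion holds at
level `E` with `c = 1` and `δ₀ = (3/2 − 2πE)/(2π√6)`: an admissible `μ` with defect `R ≤ δ₀` would
have, by L at `w = f_GP` and S, `2δ₀ ≤ R ≤ δ₀`, absurd. [folklore] -/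
theorem gpRigid_smallEnergy (f : Vec3) (hf : f = gpForce) (E : ℝ) (hE : E < 3 / (4 * Real.pi)) :
    ∃ c δ₀ : ℝ, 0 < c ∧ 0 < δ₀ ∧ ∀ μ : Measure H3, IsProbabilityMeasure μ →
      Integrable (fun v : H3 => ‖v‖ ^ 2) μ → Torus.ensembleEnergy μ ≤ E → Torus.ensembleEnstrophy μ < ⊤ →
      ∀ R : ℝ, 0 ≤ R → R ≤ δ₀ →
        (∀ Φ : Torus.CylindricalTest (Fin 3),
          Integrable (fun v : H3 => Torus.nsGeneratorPairing 0 f v (Φ.grad v)) μ ∧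
            |∫ v, Torus.nsGeneratorPairing 0 f v (Φ.grad v) ∂μ| ≤
              R * Real.sqrt (∫ v, Torus.gradNormSq (Φ.grad v) ∂μ)) →
        c ≤ R * Real.sqrt (Torus.ensembleEnstrophy μ).toReal := by
  have hpi : 0 < Real.pi := Real.pi_pos
  have hnum : 0 < 3 / 2 - 2 * Real.pi * E := by
    have h1 : 2 * Real.pi * E < 2 * Real.pi * (3 / (4 * Real.pi)) := by
      exact mul_lt_mul_of_pos_left hE (by positivity)
    have h2 : 2 * Real.pi * (3 / (4 * Real.pi)) = 3 / 2 := by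
      field_simp
      ring
    linarith
  have hden : 0 < Real.pi * Real.sqrt 6 := by positivity
  set δ₀ : ℝ := (3 / 2 - 2 * Real.pi * E) / (Real.pi * Real.sqrt 6) / 2 with hδ₀
  have hδ₀pos : 0 < δ₀ := by positivity
  refine ⟨1, δ₀, one_pos, hδ₀pos, ?_⟩
  intro μ hμ hint hEμ _hG R _hR0 hRδ hdef
  exfalso
  obtain ⟨hsm, hdf, hzm⟩ := gpForce_admissible
  have hf2 : MemLp f 2 volume := by rw [hf]; exact hsm.memLp 2
  have hL := stub_linearTestLimit f f hf2 (hf ▸ hsm) (hf ▸ hdf) (hf ▸ hzm) μ hμ hint R hdef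
  have hS := stub_gpSmallEnergy f hf E μ hμ hint hEμ R hL.2
  have : 2 * δ₀ = (3 / 2 - 2 * Real.pi * E) / (Real.pi * Real.sqrt 6) := by rw [hδ₀]; ring
  linarith

/-! ## Consequence of the side stub: the shell clause is idle -/

/-- **Desaturated form of the crux** (normal form): `GPStatisticalRigidity` implies the same statement
with the shell-work hypothesis deleted (by D); the converse is trivial. Not used in `_of`. [folklore] -/
theorem gpStatisticalRigidity_noShell
    (h : Summit.AnomalousDissipation.AnomalousDissipation.Theses.EnsembleRigidity.GPStatisticalRigidity)
    (f : Vec3) (hf : f = gpForce) (E : ℝ) :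
    ∃ c δ₀ : ℝ, 0 < c ∧ 0 < δ₀ ∧ ∀ μ : Measure H3, IsProbabilityMeasure μ →
      Integrable (fun v : H3 => ‖v‖ ^ 2) μ → Torus.ensembleEnergy μ ≤ E → Torus.ensembleEnstrophy μ < ⊤ →
      ∀ R : ℝ, 0 ≤ R → R ≤ δ₀ →
        (∀ Φ : Torus.CylindricalTest (Fin 3),
          Integrable (fun v : H3 => Torus.nsGeneratorPairing 0 f v (Φ.grad v)) μ ∧
            |∫ v, Torus.nsGeneratorPairing 0 f v (Φ.grad v) ∂μ| ≤
              R * Real.sqrt (∫ v, Torus.gradNormSq (Φ.grad v) ∂μ)) →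
        c ≤ R * Real.sqrt (Torus.ensembleEnstrophy μ).toReal := by
  obtain ⟨c, δ₀, hc, hδ₀, hrig⟩ := h f (hf.trans gpForce_eq) E
  have hf2 : MemLp f 2 volume := by rw [hf]; exact gpForce_admissible.1.memLp 2
  exact ⟨c, δ₀, hc, hδ₀, stub_desaturation f hf2 E c δ₀ hrig⟩

/-! ## The crux -/

/-- **Statistical Lamb rigidity of `f_GP`** — the route declaration
`EnsembleRigidity.GPStatisticalRigidity` (item stmt-AnomalousDissipation-15508), composed from the
registered stubs: below the second-moment horizon `E < 3/(4π)` by the cut-off removal L and the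
second-moment test S (vacuity), above it by weak duality W2 applied to the certificate family C2.
The shell-work hypothesis is not used (cf. D). -/
theorem GPStatisticalRigidity_of :
    Summit.AnomalousDissipation.AnomalousDissipation.Theses.EnsembleRigidity.GPStatisticalRigidity := by
  intro f hf E
  have hf' : f = gpForce := hf.trans gpForce_eq.symm
  by_cases hE : E < 3 / (4 * Real.pi)
  · obtain ⟨c, δ₀, hc, hδ₀, hrig⟩ := gpRigid_smallEnergy f hf' E hE
    exact ⟨c, δ₀, hc, hδ₀, fun μ hμ hint hEμ hG _hshell R hR0 hRδ hdef =>
      hrig μ hμ hint hEμ hG R hR0 hRδ hdef⟩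
  · have hE' : 3 / (4 * Real.pi) ≤ E := le_of_not_gt hE
    obtain ⟨γ, C, hγ, hC, hfam⟩ := stub_gpCertificateFamily2 f hf' E hE'
    obtain ⟨c, δ₀, hc, hδ₀, hrig⟩ := stub_weakDuality2 f E γ C hγ hC hfam
    exact ⟨c, δ₀, hc, hδ₀, fun μ hμ hint hEμ hG _hshell R hR0 hRδ hdef =>
      hrig μ hμ hint hEμ hG R hR0 hRδ hdef⟩

end Summit.AnomalousDissipation.AnomalousDissipation.Theorems.EnsembleRigidity.GPStatisticalRigidity

end
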